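import Literature.AlgebraicGeometry.Motives.AbelianVarietyWeilPairingPullback
import Literature.AlgebraicGeometry.Motives.AbelianVarietyWeilPairingDivisorClass
import HarnessLib

/-!
# Level Weil pairings of a TRANSLATED divisor, and automorphisms preserving the pairing: the inverse is a level adjoint
# (Mumford §20 (3), §6 Cor. 4 (theorem of the square); Lang VII §2 Prop. 3)

Layer `Literature/AlgebraicGeometry/Motives`, namespace `Literature.AlgebraicGeometry.Motives.AbelianVariety`.  THEOREMS ONLY (+ two private
point lemmas, [folklore]); no definition, no named fact, no instance, no `sorry`.  Sibling of `AbelianVarietyLevelAdjointCalculus` (A-p18 (g11):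
identity ∕ composition ∕ sums ∕ weights ∕ `levelAdjoint_iso_pullback` ∕ `levelAdjoint_reverse`); this file adds the two heads the push–pull
generators `t ≫ Σ_γ Alb T_γ` of the Hecke image need for their AUTOMORPHISM letters `Alb T_γ` (A-p18 (g11) re-cut 2026-08-30T04:33:09Z):

* §1 **`weilPairingLevel_pullback_translation`** — `ē_N^{t_R^*Θ}(P, Q) = ē_N^Θ(P, Q)`: the level Weil pairing of a TRANSLATE of `Θ` is that
  of `Θ` (theorem of the square: `D_Q(t_R^*Θ) = t_R^*D_Q(Θ) ∼ D_Q(Θ)`, ★ `pullback_translation_weilDiv_add_linEquiv` + ★ `weilDiv_mul_linEquiv`,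
  and `ē_N` only sees the class of `D_Q`, ★ `weilPairingLevel_eq_kummerConst_of_linEquiv`) — Mumford §6 Cor. 4 / §8: `φ_{t_x^*L} = φ_L`.
* §2 **`levelAdjoint_of_inverse_of_forall_weilPairingLevel_pullback_eq`** — if `f : A ⟶ A` (dominant) has a right inverse `g` (`g ≫ f = 𝟙`)
  and PRESERVES THE PAIRING (`ē_N^{f^*Θ} = ē_N^Θ` at every level), then `(g, 1)` is a level adjoint of `f` for `Θ` in the letter shape of ★
  `AbelianVarietyRosatiStableSubalgebra` §3 ∕ `AbelianVarietyLevelAdjointCalculus`: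
  `ē_N^Θ((1·f) P, Q) = ē_N^Θ(f P, f (g Q)) = ē_N^{f^*Θ}(P, g Q) = ē_N^Θ(P, g Q)` (★ `weilPairingLevel_pullback` = Mumford §20 (3)); corollaries
  `…_of_sameDivisor` (`f^*Θ` the same divisor as `Θ`), `…_of_linEquiv` (`f^*Θ ∼ Θ`), **`…_of_sameDivisor_translation`** (`f^*Θ` a TRANSLATE
  `t_R^*Θ` — the case of a translate-automorphism permuting the components of a curve and their theta divisors), and the `Iso` spellings
  `levelAdjoint_iso_inv_…`.

Cell `hodgecm-mathlib` (D-0151), fan A, road (P) of the d6 socket `SocketRosH` (director s211–s214; A-plan2 (g12) 04:26:57Z ∕ 04:29:02Z); consumer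
`slot_levelAdjoint` (A-p18 (g11) lead, A-p03 second).  Count-neutral; HC_CM is proved only modulo the 7 printed citations until rung 0 closes.

## References
* [MumfordAV1970] D. Mumford, *Abelian Varieties* (1970), §6 Cor. 4 (theorem of the square, p. 59), §8 (`φ_L`, pp. 74–75), §20 (p. 186, property (3)
  of `e_n`).
* [Lang1983AbelianVarieties] S. Lang, *Abelian Varieties*, Ch. VII §2 Prop. 3.
* Tree: ★ `Motives.AbelianVarietyWeilDivisor` (`weilDiv`, `pullback_translation_weilDiv_add_linEquiv`, `weilDiv_mul_linEquiv`), ★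
  `Motives.AbelianVarietyWeilPairingLevel` (`weilPairingLevel_eq_kummerConst_of_linEquiv`, `isTrivializer_weilFn`), ★ `Motives.AbelianVarietyWeilPairingPullback`
  (`weilPairingLevel_pullback`, `map_mem_torsionPoints`), ★ `Motives.AbelianVarietyWeilPairingDivisorClass` (`weilPairingLevel_congr_sameDivisor/_linEquiv`),
  ★ `Motives.CartierDivisorClassPullback` (`LinEquiv.add_right_cancel`).
-/

noncomputable section

open CategoryTheory AlgebraicGeometry

universe u

namespace Literature.AlgebraicGeometry.Motives.AbelianVariety

variable {K : Type u} [Field K] {A : AbelianVariety K}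

/-! ### §0 Point bookkeeping (private, [folklore]) -/

/-- `(u ≫ u′) Q = u′ (u Q)` on points. [folklore] -/
private theorem map_comp_pt (u u' : A ⟶ A) (Q : A.Points K) :
    AlgPoints.map (u ≫ u').hom.hom.hom Q = AlgPoints.map u'.hom.hom.hom (AlgPoints.map u.hom.hom.hom Q) :=
  (Category.assoc _ _ _).symm

/-- `𝟙 Q = Q` on points. [folklore] -/
private theorem map_id_pt (Q : A.Points K) : AlgPoints.map (𝟙 A : A ⟶ A).hom.hom.hom Q = Q :=
  AlgPoints.map_id_apply Q

/-! ### §1 The level Weil pairing of a translate -/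

/-- **`t_R^* D_Q(Θ) ∼ D_Q(Θ)`** (theorem of the square): `t_R^*D_Q + D_R ∼ D_{QR} ∼ D_Q + D_R`, cancel `D_R`.
[cite: MumfordAV1970, §6 Cor. 4 (p. 59) and §8 (pp. 74–75)] -/
theorem pullback_translation_weilDiv_linEquiv (Θ : CartierDivisor A.X.left) (Q R : A.Points K) :
    ((A.weilDiv Θ Q).pullback (A.translation R).left).LinEquiv (A.weilDiv Θ Q) :=
  CartierDivisor.LinEquiv.add_right_cancel
    ((A.pullback_translation_weilDiv_add_linEquiv Θ R Q).trans (A.weilDiv_mul_linEquiv Θ Q R))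

/-- **`D_Q(t_R^*Θ)` is the same divisor as `t_R^* D_Q(Θ)`** (`t_Q^* t_R^* = t_R^* t_Q^*`, translations commute).
[cite: MumfordAV1970, §6 Cor. 4 (p. 59) and §8 (pp. 74–75)] -/
theorem weilDiv_pullback_translation_sameDivisor (Θ : CartierDivisor A.X.left) (Q R : A.Points K) :
    (A.weilDiv (Θ.pullback (A.translation R).left) Q).SameDivisor ((A.weilDiv Θ Q).pullback (A.translation R).left) := by
  unfold weilDiv
  refine CartierDivisor.SameDivisor.trans ?_ (CartierDivisor.pullback_add_sameDivisor _ _ _).symm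
  refine CartierDivisor.SameDivisor.add ?_ (CartierDivisor.pullback_neg_sameDivisor _ Θ).symm
  have hcomm : (A.translation Q).left ≫ (A.translation R).left = (A.translation R).left ≫ (A.translation Q).left := by
    rw [← Over.comp_left, ← Over.comp_left, translation_comp', translation_comp]
  haveI : IsDominant ((A.translation Q).left ≫ (A.translation R).left) := inferInstance
  haveI : IsDominant ((A.translation R).left ≫ (A.translation Q).left) := inferInstance
  exact (Θ.pullback_pullback_sameDivisor _ _).trans
    ((Θ.pullback_congr_sameDivisor hcomm).trans (Θ.pullback_pullback_sameDivisor _ _).symm)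

/-- **The level Weil pairing of a translate: `ē_N^{t_R^*Θ}(P, Q) = ē_N^Θ(P, Q)`** — `D_Q(t_R^*Θ) ∼ D_Q(Θ)` and `ē_N` depends only on the class of
`D_Q` (Mumford §8: `φ_{t_x^*L} = φ_L`; Lang VII §2 Prop. 3). [cite: MumfordAV1970, §6 Cor. 4 (p. 59) and §8 (pp. 74–75)]
[cite: Lang1983AbelianVarieties, Ch. VII §2 Prop. 3] -/
theorem weilPairingLevel_pullback_translation (Θ : CartierDivisor A.X.left) (R : A.Points K)
    {N : ℕ} [IsDominant (Hom.toSchemeHom ((N : ℤ) • 𝟙 A))] (P Q : A.torsionPoints K N) :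
    A.weilPairingLevel (Θ.pullback (A.translation R).left) P Q = A.weilPairingLevel Θ P Q := by
  have H : (A.weilDiv (Θ.pullback (A.translation R).left) Q.1).LinEquiv (A.weilDiv Θ Q.1) :=
    (weilDiv_pullback_translation_sameDivisor Θ Q.1 R).linEquiv.trans (pullback_translation_weilDiv_linEquiv Θ Q.1 R)
  rw [weilPairingLevel_eq_kummerConst_of_linEquiv (A.isTrivializer_weilFn Θ Q) H P]
  rfl

/-- The same for any presentation `Θ′` of the translate (`Θ′` the same divisor as `t_R^*Θ`). [cite: MumfordAV1970, §6 Cor. 4 (p. 59) and §8 (pp. 74–75)] -/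
theorem weilPairingLevel_eq_of_sameDivisor_translation {Θ' : CartierDivisor A.X.left} (Θ : CartierDivisor A.X.left) (R : A.Points K)
    (hΘ' : Θ'.SameDivisor (Θ.pullback (A.translation R).left))
    {N : ℕ} [IsDominant (Hom.toSchemeHom ((N : ℤ) • 𝟙 A))] (P Q : A.torsionPoints K N) :
    A.weilPairingLevel Θ' P Q = A.weilPairingLevel Θ P Q := by
  rw [weilPairingLevel_congr_sameDivisor hΘ' P Q, weilPairingLevel_pullback_translation Θ R P Q]

/-! ### §2 An automorphism preserving the pairing: the inverse is a level adjoint -/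

/-- **An automorphism preserving the pairing has its inverse as level adjoint.**  Let `f : A ⟶ A` be dominant with `g ≫ f = 𝟙`, and suppose the
level pairings of `f^*Θ` and `Θ` agree (`ē_N^{f^*Θ}(P, Q) = ē_N^Θ(P, Q)` for all `N, P, Q`).  Then `(g, 1)` is a level adjoint of `f`:
`ē_N^Θ((1·f) P, Q) = ē_N^Θ(f P, f (g Q)) = ē_N^{f^*Θ}(P, g Q) = ē_N^Θ(P, g Q)` — in the letter shape of ★ `AbelianVarietyRosatiStableSubalgebra` §3
(weight `d = 1`). [cite: MumfordAV1970, §20 (p. 186, property (3) of e_n)] [cite: Lang1983AbelianVarieties, Ch. VII §2 Prop. 3] -/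
theorem levelAdjoint_of_inverse_of_forall_weilPairingLevel_pullback_eq (Θ : CartierDivisor A.X.left) {f g : A ⟶ A}
    [IsDominant (Hom.toSchemeHom f)] (hgf : g ≫ f = 𝟙 A)
    (hΘ : ∀ (N : ℕ) [IsDominant (Hom.toSchemeHom ((N : ℤ) • 𝟙 A))] (P Q : A.torsionPoints K N),
      A.weilPairingLevel (Θ.pullback (Hom.toSchemeHom f)) P Q = A.weilPairingLevel Θ P Q)
    (N : ℕ) [IsDominant (Hom.toSchemeHom ((N : ℤ) • 𝟙 A))] (P Q : A.torsionPoints K N) :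
    A.weilPairingLevel Θ ⟨AlgPoints.map (((1 : ℕ) : ℤ) • f).hom.hom.hom P.1, map_mem_torsionPoints (((1 : ℕ) : ℤ) • f) P.2⟩ Q =
      A.weilPairingLevel Θ P ⟨AlgPoints.map g.hom.hom.hom Q.1, map_mem_torsionPoints g Q.2⟩ := by
  have eP : (⟨AlgPoints.map (((1 : ℕ) : ℤ) • f).hom.hom.hom P.1, map_mem_torsionPoints (((1 : ℕ) : ℤ) • f) P.2⟩ : A.torsionPoints K N) =
      ⟨AlgPoints.map f.hom.hom.hom P.1, map_mem_torsionPoints f P.2⟩ :=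
    Subtype.ext (by rw [Nat.cast_one, one_smul])
  have eQ : (⟨AlgPoints.map f.hom.hom.hom (AlgPoints.map g.hom.hom.hom Q.1), map_mem_torsionPoints f (map_mem_torsionPoints g Q.2)⟩ :
      A.torsionPoints K N) = Q :=
    Subtype.ext (show AlgPoints.map f.hom.hom.hom (AlgPoints.map g.hom.hom.hom Q.1) = Q.1 by rw [← map_comp_pt, hgf, map_id_pt])
  rw [eP, ← hΘ N P ⟨AlgPoints.map g.hom.hom.hom Q.1, map_mem_torsionPoints g Q.2⟩, weilPairingLevel_pullback f Θ, eQ]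

/-- The same when `f^*Θ` is the SAME DIVISOR as `Θ`. [cite: MumfordAV1970, §20 (p. 186, property (3) of e_n)] -/
theorem levelAdjoint_of_inverse_of_sameDivisor (Θ : CartierDivisor A.X.left) {f g : A ⟶ A}
    [IsDominant (Hom.toSchemeHom f)] (hgf : g ≫ f = 𝟙 A) (hΘ : (Θ.pullback (Hom.toSchemeHom f)).SameDivisor Θ)
    (N : ℕ) [IsDominant (Hom.toSchemeHom ((N : ℤ) • 𝟙 A))] (P Q : A.torsionPoints K N) :
    A.weilPairingLevel Θ ⟨AlgPoints.map (((1 : ℕ) : ℤ) • f).hom.hom.hom P.1, map_mem_torsionPoints (((1 : ℕ) : ℤ) • f) P.2⟩ Q =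
      A.weilPairingLevel Θ P ⟨AlgPoints.map g.hom.hom.hom Q.1, map_mem_torsionPoints g Q.2⟩ :=
  levelAdjoint_of_inverse_of_forall_weilPairingLevel_pullback_eq Θ hgf
    (fun _ _ P' Q' => weilPairingLevel_congr_sameDivisor hΘ P' Q') N P Q

/-- The same when `f^*Θ` is LINEARLY EQUIVALENT to `Θ`. [cite: Lang1983AbelianVarieties, Ch. VII §2 Prop. 3] -/
theorem levelAdjoint_of_inverse_of_linEquiv (Θ : CartierDivisor A.X.left) {f g : A ⟶ A}
    [IsDominant (Hom.toSchemeHom f)] (hgf : g ≫ f = 𝟙 A) (hΘ : (Θ.pullback (Hom.toSchemeHom f)).LinEquiv Θ)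
    (N : ℕ) [IsDominant (Hom.toSchemeHom ((N : ℤ) • 𝟙 A))] (P Q : A.torsionPoints K N) :
    A.weilPairingLevel Θ ⟨AlgPoints.map (((1 : ℕ) : ℤ) • f).hom.hom.hom P.1, map_mem_torsionPoints (((1 : ℕ) : ℤ) • f) P.2⟩ Q =
      A.weilPairingLevel Θ P ⟨AlgPoints.map g.hom.hom.hom Q.1, map_mem_torsionPoints g Q.2⟩ :=
  levelAdjoint_of_inverse_of_forall_weilPairingLevel_pullback_eq Θ hgf
    (fun _ _ P' Q' => weilPairingLevel_congr_linEquiv hΘ P' Q') N P Q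

/-- **The translate case**: `g ≫ f = 𝟙` and `f^*Θ` is (the same divisor as) a TRANSLATE `t_R^*Θ` — e.g. `f` a translate-automorphism of a
disjoint union of curves acting on the product of their Jacobians, permuting the Riemann theta divisors up to translation — then `(g, 1)` is a level
adjoint of `f` for `Θ` (§1 + the pairing-invariant form). [cite: MumfordAV1970, §6 Cor. 4 (p. 59) and §8 (pp. 74–75)]
[cite: MumfordAV1970, §20 (p. 186, property (3) of e_n)] -/
theorem levelAdjoint_of_inverse_of_sameDivisor_translation (Θ : CartierDivisor A.X.left) {f g : A ⟶ A}
    [IsDominant (Hom.toSchemeHom f)] (hgf : g ≫ f = 𝟙 A) (R : A.Points K)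
    (hΘ : (Θ.pullback (Hom.toSchemeHom f)).SameDivisor (Θ.pullback (A.translation R).left))
    (N : ℕ) [IsDominant (Hom.toSchemeHom ((N : ℤ) • 𝟙 A))] (P Q : A.torsionPoints K N) :
    A.weilPairingLevel Θ ⟨AlgPoints.map (((1 : ℕ) : ℤ) • f).hom.hom.hom P.1, map_mem_torsionPoints (((1 : ℕ) : ℤ) • f) P.2⟩ Q =
      A.weilPairingLevel Θ P ⟨AlgPoints.map g.hom.hom.hom Q.1, map_mem_torsionPoints g Q.2⟩ :=
  levelAdjoint_of_inverse_of_forall_weilPairingLevel_pullback_eq Θ hgf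
    (fun _ _ P' Q' => weilPairingLevel_eq_of_sameDivisor_translation Θ R hΘ P' Q') N P Q

/-- **`Iso` spelling**: for an automorphism `φ : A ≅ A` preserving the pairing of `Θ` (`ē_N^{φ^*Θ} = ē_N^Θ`), `(φ.inv, 1)` is a level adjoint of
`φ.hom`. [cite: MumfordAV1970, §20 (p. 186, property (3) of e_n)] -/
theorem levelAdjoint_iso_inv_of_forall_weilPairingLevel_pullback_eq (Θ : CartierDivisor A.X.left) (φ : A ≅ A)
    [IsDominant (Hom.toSchemeHom φ.hom)]
    (hΘ : ∀ (N : ℕ) [IsDominant (Hom.toSchemeHom ((N : ℤ) • 𝟙 A))] (P Q : A.torsionPoints K N),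
      A.weilPairingLevel (Θ.pullback (Hom.toSchemeHom φ.hom)) P Q = A.weilPairingLevel Θ P Q)
    (N : ℕ) [IsDominant (Hom.toSchemeHom ((N : ℤ) • 𝟙 A))] (P Q : A.torsionPoints K N) :
    A.weilPairingLevel Θ ⟨AlgPoints.map (((1 : ℕ) : ℤ) • φ.hom).hom.hom.hom P.1, map_mem_torsionPoints (((1 : ℕ) : ℤ) • φ.hom) P.2⟩ Q =
      A.weilPairingLevel Θ P ⟨AlgPoints.map φ.inv.hom.hom.hom Q.1, map_mem_torsionPoints φ.inv Q.2⟩ :=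
  levelAdjoint_of_inverse_of_forall_weilPairingLevel_pullback_eq Θ φ.inv_hom_id hΘ N P Q

/-- **`Iso` spelling, translate case**: `φ^*Θ` the same divisor as `t_R^*Θ` ⇒ `(φ.inv, 1)` is a level adjoint of `φ.hom` for `Θ`.
[cite: MumfordAV1970, §6 Cor. 4 (p. 59) and §8 (pp. 74–75)] [cite: MumfordAV1970, §20 (p. 186, property (3) of e_n)] -/
theorem levelAdjoint_iso_inv_of_sameDivisor_translation (Θ : CartierDivisor A.X.left) (φ : A ≅ A)
    [IsDominant (Hom.toSchemeHom φ.hom)] (R : A.Points K)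
    (hΘ : (Θ.pullback (Hom.toSchemeHom φ.hom)).SameDivisor (Θ.pullback (A.translation R).left))
    (N : ℕ) [IsDominant (Hom.toSchemeHom ((N : ℤ) • 𝟙 A))] (P Q : A.torsionPoints K N) :
    A.weilPairingLevel Θ ⟨AlgPoints.map (((1 : ℕ) : ℤ) • φ.hom).hom.hom.hom P.1, map_mem_torsionPoints (((1 : ℕ) : ℤ) • φ.hom) P.2⟩ Q =
      A.weilPairingLevel Θ P ⟨AlgPoints.map φ.inv.hom.hom.hom Q.1, map_mem_torsionPoints φ.inv Q.2⟩ :=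
  levelAdjoint_of_inverse_of_sameDivisor_translation Θ φ.inv_hom_id R hΘ N P Q

end Literature.AlgebraicGeometry.Motives.AbelianVariety

end
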